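/-
Copyright (c) 2026 the pub-hodgecm-mathlib formalisation cell (harness21).  Prover seat hodgecm-mathlib-F0P3a-p01 (g39), explicit-unit SUPPORTS-ONLY on h413, req620 Track A
«(D-RAM) FOUR-FRAME» squad ((β₂) road (R-36), lane A (Unr-K): the Θ-FIXED reference pair of the RAMIFIED third field `Fix Θ` on type U — non-integral `κ₀` of the
exact size `exp(d − 1)`, anti `ξ₀` of order `≡ d (mod 2)`; the «road (I)» companion of `…ThetaRhoDatumOfTypeU`'s Θρ-chart), 2026-09-05.
-/
import Summits.HodgeConjecture.HodgeConjecture.Theorems.F0P3cDyRamUnrKNoThetaFixedChart   -- ★ p864921 (this seat): no INTEGRAL Θ-fixed chart on type U; brings ★ p864540, ★ `…TypeUBottomFacts` (→ ★ `…ThirdFieldPackageUnr.exists_thirdFieldPackage_unr`)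
import HarnessLib

/-!
# Crux `H413`, line LH4 «(D-RAM) FOUR-FRAME» — (β₂) road, lane A (type U ∕ Unr-K): «THE Θ-FIXED REFERENCE PAIR OF THE RAMIFIED THIRD FIELD» —
# `κ₀ = π′∕(π′ − σ′π′) ∈ Fix Θ` with `Tr_ρ κ₀ = 1`, `|κ₀| = exp(d − 1)`, and anti `ξ₀ ∈ Fix Θ` of every order `2k − d`

Cell `hodgecm-mathlib` (D-0151), FLOOR 0, crux item H413 = `stmt-HodgeConjecture-24833`, route of record `HCCMUnconditional`; squad F0∕P3c∕LH4; lane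
`--supports stmt-HodgeConjecture-24833 --as helper` (count-neutral; pays NO tier-0 row).  THEOREMS ONLY (no `def`, no instance, no notation, no `sorry`, default heartbeats);
★-only imports; states NO census law; (β₂) stays a HYPOTHESIS.

WHY (LH4-p19 (g3) RAYBANDS ENGINE MAP v1 `F0/P3c/LH4/LH4-p19/g3/RAYBANDS-ENGINE-MAP.v1.LH4p19g3.md` §«reference-pair interface» (R1)–(R4); this seat's ★ p864921 and
`…ThetaRhoDatumOfTypeU`).  The RAY∕CORE engines consume a chart `(κ₀, ξ₀)` through (R1) `κ₀ + ρκ₀ = 1`, `Θκ₀ = κ₀`, `ρξ₀ = −ξ₀`, `Θξ₀ = ξ₀`, `ξ₀ ≠ 0`, (R2) `|ξ₀|` = the cell's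
radius, (R3) `|κ₀| ≤ |ξ₀|` — and, in SOME files (★ W2 `…UpperRayCellLetters`, ★ `…LowerLineCellLetters`, ★ `…RowInsideChartLetters`, F1b), the integrality `|κ₀| ≤ 1`, which ★ p864921
REFUTES on type U.  The member's digit `κ` IS Θ-fixed (adjoint structure, ★ `exists_coord_of_gen` ∕ ★ `exists_doublyFixed_coord`), so the lane-A digit line is still the `E₀`-line
`κ₀ + jE(V)·ξ₀ ⊂ Fix Θ` — but on type U `Fix Θ = K♮` is the RAMIFIED third field (★ `exists_thirdFieldPackage_unr`: a Θ-fixed uniformiser `π′` with `|π′ − ρπ′| = |π′|^d`), so its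
trace-one point is `κ₀ := π′∕(π′ − ρπ′)` of the EXACT non-integral size `|κ₀| = exp(d − 1)` and its anti elements `ξ₀ ∈ (π′ − ρπ′)·E₀` have orders `≡ d (mod 2)` — matching the
Unr-K atlas (★ p861798 §3: the HYPERBOLIC tower sits at `j − b = d + 2i`, radius `exp(j − b) ≡ d (mod 2)`).  THIS FILE types that pair («road (I)»: Θ-fixed, non-integral),
the companion of `…ThetaRhoDatumOfTypeU` §6 («road (II)»: Θρ-fixed, integral); which road the lane-A per-cell files take is the K6 desk's ∕ LH4-p19's call.
* §1 `exists_theta_fixed_tracePoint_of_typeU` — `κ₀ ∈ Fix Θ`, `κ₀ + ρκ₀ = 1`, `|κ₀| = exp(d − 1)`, and the unit-free anti `ξ₁ = π′ − ρπ′ ∈ Fix Θ`, `|ξ₁| = exp(−d)`.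
* §2 HEAD `exists_theta_refPair_of_typeU` — for every `k : ℤ`: `κ₀ ξ₀ ∈ Fix Θ` with (R1), `|κ₀| = exp(d − 1)`, `|ξ₀| = exp(2k − d)` (scale `ξ₁` by the doubly fixed
  `jE(ϖσϖ)^{−k}`); (R3) `|κ₀| ≤ |ξ₀|` holds iff `2d − 1 ≤ 2k`.
Letters ⊆ ‹OFF-A.letter.v2›'s: `_hD jE _hρρ _hvρ _hρj _hjfix _hΘj _hΘΘ _hΘρ _hvΘ _hα1 _hU _hτ _hjiso _hq _hddE _hfixE` (+ `[CompleteSpace M] [IsDiscreteValuationRing 𝒪[M]] [Finite 𝓀[M]]`).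
HONEST LABEL.  Count-neutral local algebra; nothing printed is asserted; no census law is stated; the lane-A letters and (β₂) `stub_law_cleanSgn₂` stay HYPOTHESES ∕ UNPROVED;
`HC_CM` is proved only modulo the 7 printed citations (2 remaining named inputs: hLiu418 = `stmt-HodgeConjecture-24832`, h413 = `stmt-HodgeConjecture-24833`) until rung 0 closes.
## References
* [Serre1979] J.-P. Serre, *Local Fields*, GTM 67 (1979): Ch. III §3 Prop. 7 (trace and different of a ramified quadratic extension), Ch. III §6 Prop. 12, Ch. V §3 Cor. 3.
* [Rogawski1990] J. D. Rogawski, *Automorphic Representations of Unitary Groups in Three Variables*, Ann. of Math. Stud. 123 (1990): §4.9 Lemma 4.9.3 p. 56.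
* [Kottwitz1986BaseChangeUnits] R. E. Kottwitz, *Base change for unit elements of Hecke algebras*, Compositio Math. 60 (1986): §1 pp. 240–241.
-/

set_option autoImplicit false

noncomputable section

namespace Summit.HodgeConjecture.HodgeConjecture.Cruxes.H413.F0P3cDyRamUnrKThetaFixedRefPair

open scoped Valued WithZero
open WithZero
open Literature.NumberTheory.Automorphic.UnitaryThreeFourFrame (IsRamifiedQuadraticDatum)
open Summit.HodgeConjecture.HodgeConjecture.Cruxes.H413.F0P3cDyRamThirdFieldPackageUnr (exists_thirdFieldPackage_unr)

variable {M : Type} [Field M] [Valued M ℤᵐ⁰] {ρ Θ : M →+* M} {α : M}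

/-! ## §1 The trace-one point and the unit-free anti element of the ramified third field -/

/-- **THE Θ-FIXED TRACE-ONE POINT ON TYPE U**: from the Unr-K third-field package (★ `exists_thirdFieldPackage_unr`: a Θ-fixed `π′` with `|π′| = exp(−1)`, `|π′ − ρπ′| = |π′|^d`),
`κ₀ := π′∕(π′ − ρπ′)` is Θ-fixed with `κ₀ + ρκ₀ = 1` and `|κ₀| = exp(d − 1)`, and `ξ₁ := π′ − ρπ′` is Θ-fixed, ρ-anti, non-zero, `|ξ₁| = exp(−d)`.
[cite: Serre1979, Ch. III §3 Prop. 7; Ch. III §6 Prop. 12] -/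
theorem exists_theta_fixed_tracePoint_of_typeU [CompleteSpace M] [IsDiscreteValuationRing 𝒪[M]] [Finite 𝓀[M]]
    {E : Type} [Field E] [Valued E ℤᵐ⁰] {σ : E →+* E} {ϖ : E} {d tE : ℕ} (hD : IsRamifiedQuadraticDatum σ ϖ d tE)
    (jE : E →+* M) (hρρ : ∀ x, ρ (ρ x) = x) (hvρ : ∀ x, Valued.v (ρ x) = Valued.v x) (hρj : ∀ a, ρ (jE a) = jE a)
    (hΘΘ : ∀ x, Θ (Θ x) = x) (hΘρ : ∀ x, Θ (ρ x) = ρ (Θ x)) (hvΘ : ∀ x, Valued.v (Θ x) = Valued.v x)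
    (hα1 : Valued.v α ≤ 1) (hU : Valued.v (α - ρ α) = 1) (hτ : Valued.v (ρ α - Θ α) < 1)
    (hjiso : ∀ a, Valued.v (jE a) = Valued.v a) (hq : Nat.card 𝓀[M] = Nat.card 𝓀[E] ^ 2) (hddE : Valued.v (jE ϖ - Θ (jE ϖ)) = Valued.v (jE ϖ) ^ d)
    (hfixE : ∀ z : M, ρ z = z → Θ z = z → z ≠ 0 → ∃ n : ℤ, Valued.v z = WithZero.exp (2 * n)) :
    ∃ κ₀ ξ₁ : M, κ₀ + ρ κ₀ = 1 ∧ Θ κ₀ = κ₀ ∧ Valued.v κ₀ = exp ((d : ℤ) - 1) ∧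
      ρ ξ₁ = -ξ₁ ∧ Θ ξ₁ = ξ₁ ∧ ξ₁ ≠ 0 ∧ Valued.v ξ₁ = exp (-(d : ℤ)) := by
  obtain ⟨-, -, hϖ, -, -, -, -⟩ := id hD
  have hjϖ : Valued.v (jE ϖ) = exp (-1 : ℤ) := by rw [hjiso, hϖ]
  obtain ⟨K', _iF, _iV, σ', π', jK, _hDVR, _hfin, -, hσ'σ', -, -, hπ', hdd', hjKv, hjKΘ, -, hjKσ, -⟩ :=
    exists_thirdFieldPackage_unr hq hρρ hvρ hΘΘ hΘρ hvΘ hα1 hU hτ (hρj ϖ) hjϖ hddE hfixE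
  -- the images `p := jK π′`, `ξ₁ := p − ρ p = jK (π′ − σ′ π′)`
  set p : M := jK π' with hp
  have hvp : Valued.v p = exp (-1 : ℤ) := by rw [hp, hjKv, hπ']
  have hρp : ρ p = jK (σ' π') := by rw [hp, hjKσ]
  have hξ₁v : Valued.v (p - ρ p) = exp (-(d : ℤ)) := by
    rw [hρp, hp, ← map_sub, hjKv, hdd', hπ', ← exp_nsmul, nsmul_eq_mul, mul_neg, mul_one]
  have hξ₁0 : p - ρ p ≠ 0 := fun h0 => by rw [h0, map_zero] at hξ₁v; exact (exp_ne_zero hξ₁v.symm).elim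
  refine ⟨p / (p - ρ p), p - ρ p, ?_, ?_, ?_, ?_, ?_, hξ₁0, hξ₁v⟩
  · rw [map_div₀, map_sub, hρρ, ← neg_sub p (ρ p), div_neg, ← sub_eq_add_neg, ← sub_div, div_self hξ₁0]
  · rw [map_div₀, map_sub, hρp, hp, hjKΘ, hjKΘ]
  · rw [Valuation.map_div, hvp, hξ₁v, ← exp_sub]; congr 1; ring
  · rw [map_sub, hρρ]; ring
  · rw [map_sub, hρp, hp, hjKΘ, hjKΘ]

/-! ## §2 HEAD — the Θ-fixed reference pair of prescribed order `2k − d` -/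

/-- **HEAD — THE Θ-FIXED (NON-INTEGRAL) REFERENCE PAIR ON TYPE U**: for every `k : ℤ` there are `κ₀ ξ₀ ∈ Fix Θ` with `κ₀ + ρκ₀ = 1`, `Θκ₀ = κ₀`, `ρξ₀ = −ξ₀`, `Θξ₀ = ξ₀`, `ξ₀ ≠ 0`,
`|κ₀| = exp(d − 1)` and `|ξ₀| = exp(2k − d)` (`ξ₀ := ξ₁·jE(ϖσϖ)^{−k}`): the engine's (R1) with the lane-A sizes — `κ₀` NON-integral (cf. ★ p864921), `ξ₀` of order `≡ d (mod 2)`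
(the radius parity of the Unr-K HYPERBOLIC tower `j − b = d + 2i`, ★ p861798 §3); (R3) `|κ₀| ≤ |ξ₀|` iff `2d − 1 ≤ 2k`.
[cite: Serre1979, Ch. III §3 Prop. 7; Ch. V §3 Cor. 3] [cite: Rogawski1990, §4.9 Lemma 4.9.3 p. 56] [cite: Kottwitz1986BaseChangeUnits, §1 pp. 240–241] -/
theorem exists_theta_refPair_of_typeU [CompleteSpace M] [IsDiscreteValuationRing 𝒪[M]] [Finite 𝓀[M]]
    {E : Type} [Field E] [Valued E ℤᵐ⁰] {σ : E →+* E} {ϖ : E} {d tE : ℕ} (hD : IsRamifiedQuadraticDatum σ ϖ d tE)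
    (jE : E →+* M) (hρρ : ∀ x, ρ (ρ x) = x) (hvρ : ∀ x, Valued.v (ρ x) = Valued.v x) (hρj : ∀ a, ρ (jE a) = jE a)
    (hΘj : ∀ a, Θ (jE a) = jE (σ a))
    (hΘΘ : ∀ x, Θ (Θ x) = x) (hΘρ : ∀ x, Θ (ρ x) = ρ (Θ x)) (hvΘ : ∀ x, Valued.v (Θ x) = Valued.v x)
    (hα1 : Valued.v α ≤ 1) (hU : Valued.v (α - ρ α) = 1) (hτ : Valued.v (ρ α - Θ α) < 1)
    (hjiso : ∀ a, Valued.v (jE a) = Valued.v a) (hq : Nat.card 𝓀[M] = Nat.card 𝓀[E] ^ 2) (hddE : Valued.v (jE ϖ - Θ (jE ϖ)) = Valued.v (jE ϖ) ^ d)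
    (hfixE : ∀ z : M, ρ z = z → Θ z = z → z ≠ 0 → ∃ n : ℤ, Valued.v z = WithZero.exp (2 * n)) (k : ℤ) :
    ∃ κ₀ ξ₀ : M, κ₀ + ρ κ₀ = 1 ∧ Θ κ₀ = κ₀ ∧ ρ ξ₀ = -ξ₀ ∧ Θ ξ₀ = ξ₀ ∧ ξ₀ ≠ 0 ∧
      Valued.v κ₀ = exp ((d : ℤ) - 1) ∧ Valued.v ξ₀ = exp (2 * k - (d : ℤ)) := by
  obtain ⟨hσσ, hvσ, hϖ, -, -, -, -⟩ := id hD
  obtain ⟨κ₀, ξ₁, hκ, hΘκ, hκv, hρξ₁, hΘξ₁, hξ₁0, hξ₁v⟩ :=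
    exists_theta_fixed_tracePoint_of_typeU hD jE hρρ hvρ hρj hΘΘ hΘρ hvΘ hα1 hU hτ hjiso hq hddE hfixE
  -- the doubly fixed scaling `P₀ = jE (ϖσϖ)`, `|P₀| = exp(−2)`
  set P₀ : M := jE (ϖ * σ ϖ) with hP₀
  have hP₀v : Valued.v P₀ = exp (-2 : ℤ) := by rw [hP₀, hjiso, Valuation.map_mul, hvσ, hϖ, ← exp_add]; norm_num
  have hP₀0 : P₀ ≠ 0 := fun h0 => by rw [h0, map_zero] at hP₀v; exact (exp_ne_zero hP₀v.symm).elim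
  have hρP₀ : ρ P₀ = P₀ := hρj _
  have hΘP₀ : Θ P₀ = P₀ := by rw [hP₀, hΘj, map_mul, hσσ, mul_comm]
  refine ⟨κ₀, ξ₁ * (P₀ ^ k)⁻¹, hκ, hΘκ, ?_, ?_, mul_ne_zero hξ₁0 (inv_ne_zero (zpow_ne_zero _ hP₀0)), hκv, ?_⟩
  · rw [map_mul, hρξ₁, map_inv₀, map_zpow₀, hρP₀, neg_mul]
  · rw [map_mul, hΘξ₁, map_inv₀, map_zpow₀, hΘP₀]
  · rw [Valuation.map_mul, map_inv₀, map_zpow₀, hξ₁v, hP₀v, ← exp_zsmul, ← exp_neg, ← exp_add]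
    congr 1
    rw [smul_eq_mul]; ring

end Summit.HodgeConjecture.HodgeConjecture.Cruxes.H413.F0P3cDyRamUnrKThetaFixedRefPair

end
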